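import Mathlib
import HarnessLib

/-!
# The Matomäki–Radziwiłł–Tao window integral is a discrete sum

Support lemma for the crux `DigitPolyUniformity` (stmt-QuantumAdvantage-1392), line `Sketch`
(`Cruxes/DigitPolyUniformity/Lines/SketchLAR.lean`, cycle 5: the Matomäki–Radziwiłł–Tao classes).
The integral `∫_0^X ‖Σ_{n ∈ Icc ⌈x⌉₊ ⌊x+H⌋₊} c n‖ dx` of Matomäki–Radziwiłł–Tao 2015, Theorem 1.3
(`Literature.NumberTheory.LFunctions.Tao2016.MatomakiRadziwillTao2015_theorem13_holds`) is, for
natural `H` and `X`, the discrete sum `Σ_{a=1}^{X} ‖Σ_{n ∈ [a, a+H)} c n‖` over integer left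
end-points: on each open unit interval `x ∈ (a−1, a)` one has `⌈x⌉₊ = a` and `⌊x+H⌋₊ = a−1+H`, so
the window `Icc ⌈x⌉₊ ⌊x+H⌋₊` is the integer window `Ico a (a+H)` and the integrand is constant there;
the end-points form a null set.

Main result: `stub_integral_window_eq_sum`; the pointwise window identity is
`WindowIntegral.window_Icc_eq_Ico_of_mem_Ioo`.
-/

noncomputable section

namespace Summit.QuantumAdvantage.DigitPolyUniformity.SketchLAR

open Finset MeasureTheory

namespace WindowIntegral

/-- On the open unit interval `(k, k+1)` (`k` a natural number) the Matomäki–Radziwiłł–Tao window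
`Icc ⌈x⌉₊ ⌊x + H⌋₊` (`H` a natural number) is the integer window `Ico (k+1) (k+1+H)`. [folklore] -/
theorem window_Icc_eq_Ico_of_mem_Ioo (H : ℕ) {k : ℕ} {x : ℝ}
    (hx : x ∈ Set.Ioo (k : ℝ) ((k + 1 : ℕ) : ℝ)) :
    Icc ⌈x⌉₊ ⌊x + (H : ℝ)⌋₊ = Ico (k + 1) (k + 1 + H) := by
  have hk0 : (0 : ℝ) ≤ k := Nat.cast_nonneg k
  obtain ⟨hx1, hx2⟩ := hx
  push_cast at hx2
  have hceil : ⌈x⌉₊ = k + 1 := by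
    rw [Nat.ceil_eq_iff (Nat.add_one_ne_zero k), Nat.add_sub_cancel]
    push_cast
    exact ⟨hx1, hx2.le⟩
  have hfloor : ⌊x + (H : ℝ)⌋₊ = k + H := by
    rw [Nat.floor_eq_iff (by linarith)]
    push_cast
    exact ⟨by linarith, by linarith⟩
  rw [hceil, hfloor]
  ext n
  simp only [Finset.mem_Icc, Finset.mem_Ico]
  omega

end WindowIntegral

/-- **The MRT window integral is a discrete sum (c5/S2a).** For any sequence `c` and naturals
`H, X`: `∫_0^X ‖Σ_{n ∈ Icc ⌈x⌉₊ ⌊x+H⌋₊} c n‖ dx = Σ_{a=1}^{X} ‖Σ_{n ∈ [a, a+H)} c n‖` — on each unit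
interval `x ∈ (a−1, a)` the window of Matomäki–Radziwiłł–Tao's Theorem 1.3 is the integer window
`[a, a+H)`, and the integer end-points are Lebesgue-null. [folklore] -/
theorem stub_integral_window_eq_sum (c : ℕ → ℂ) (H X : ℕ) :
    ∫ x in (0 : ℝ)..(X : ℝ), ‖∑ n ∈ Icc ⌈x⌉₊ ⌊x + (H : ℝ)⌋₊, c n‖ =
      ∑ a ∈ Icc 1 X, ‖∑ n ∈ Ico a (a + H), c n‖ := by
  set f : ℝ → ℝ := fun x => ‖∑ n ∈ Icc ⌈x⌉₊ ⌊x + (H : ℝ)⌋₊, c n‖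
  -- the integrand is constant on each open unit interval `(k, k+1)`
  have hval : ∀ (k : ℕ) (x : ℝ), x ∈ Set.Ioo (k : ℝ) ((k + 1 : ℕ) : ℝ) →
      f x = ‖∑ n ∈ Ico (k + 1) (k + 1 + H), c n‖ := by
    intro k x hx
    show ‖∑ n ∈ Icc ⌈x⌉₊ ⌊x + (H : ℝ)⌋₊, c n‖ = _
    rw [WindowIntegral.window_Icc_eq_Ico_of_mem_Ioo H hx]
  have hle : ∀ k : ℕ, (k : ℝ) ≤ ((k + 1 : ℕ) : ℝ) := fun k => by push_cast; linarith
  -- hence interval integrable on each unit interval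
  have hint : ∀ k : ℕ, IntervalIntegrable f volume (k : ℝ) ((k + 1 : ℕ) : ℝ) := by
    intro k
    rw [intervalIntegrable_iff_integrableOn_Ioo_of_le (hle k)]
    exact (integrableOn_const (C := ‖∑ n ∈ Ico (k + 1) (k + 1 + H), c n‖)
      (hs := measure_Ioo_lt_top.ne)).congr_fun (fun x hx => (hval k x hx).symm) measurableSet_Ioo
  -- with integral equal to the constant value
  have hpiece : ∀ k : ℕ, ∫ x in (k : ℝ)..((k + 1 : ℕ) : ℝ), f x =
      ‖∑ n ∈ Ico (k + 1) (k + 1 + H), c n‖ := by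
    intro k
    rw [intervalIntegral.integral_of_le (hle k), integral_Ioc_eq_integral_Ioo,
      setIntegral_congr_fun measurableSet_Ioo (fun x hx => hval k x hx), setIntegral_const,
      Real.volume_real_Ioo_of_le (hle k),
      show ((k + 1 : ℕ) : ℝ) - (k : ℝ) = 1 by push_cast; ring, one_smul]
  calc ∫ x in (0 : ℝ)..(X : ℝ), f x
      = ∑ k ∈ range X, ∫ x in (k : ℝ)..((k + 1 : ℕ) : ℝ), f x := by
        rw [intervalIntegral.sum_integral_adjacent_intervals (a := fun k : ℕ => (k : ℝ))
          (fun k _ => hint k)]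
        simp
    _ = ∑ k ∈ range X, ‖∑ n ∈ Ico (k + 1) (k + 1 + H), c n‖ :=
        Finset.sum_congr rfl fun k _ => hpiece k
    _ = ∑ a ∈ Icc 1 X, ‖∑ n ∈ Ico a (a + H), c n‖ := by
        rw [Finset.range_eq_Ico, Finset.sum_Ico_add' (fun a => ‖∑ n ∈ Ico a (a + H), c n‖) 0 X 1]
        congr 1

end Summit.QuantumAdvantage.DigitPolyUniformity.SketchLAR

end
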